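import Mathlib
import HarnessLib
import Literature.Combinatorics.Additive.Pollard
import Literature.Combinatorics.Additive.Kneser
import Literature.Combinatorics.Additive.GrynkiewiczPollardRep
import Literature.Combinatorics.Additive.GrynkiewiczPollardKneserTools

/-!
# The Pollard–Kneser bound with the defect of the group (Green–Ruzsa 2005, Proposition 27)

Topic: `Literature/Combinatorics/Additive`.  B. Green, I. Z. Ruzsa, *Sum-free sets in abelian groups*, Israel J.
Math. 147 (2005) 157–188 (arXiv:math/0307142), §6 «A Pollard–Kneser result», **Proposition 27** (held
`paper:arxiv-math_0307142`, chunk p0011, read 2026-08-28; in later literature «Theorem (Green–Ruzsa)», e.g.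
Hamidoune–Serra arXiv:0804.2593 Thm 2, Grynkiewicz–Wang arXiv:2601.17922 §1):

«Write `D = D(G)` [the size of the largest proper subgroup of the finite abelian group `G`, the *defect*].
Suppose that `A` and `B` are subsets of `G` with cardinalities `k` and `l` respectively, and suppose that
`t ≤ min(k, l)` is a non-negative integer.  Then `Σ_x min(t, r(A,B,x)) ≥ t · min(n, k + l − D − t)`.»
(`n = |G|`, `r(A,B,x) = #{(a,b) ∈ A × B : a + b = x}`.)  For `G` of prime order `D = 1` and this is Pollard's
theorem (tree: `Literature.Combinatorics.Additive.pollard`).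

The proof is the printed one (induction on `l`; the case `t = l`; the pigeonhole case `k + l − D − t > n`;
`0 ∈ B`; Case 1 `A + B = A` — then `B ⊆ stab(A)`, so `D ≥ l` unless `A = G`; Case 2: translate `A` so that
`0 ∈ A`, `B ⊄ A`, and use the Dyson decomposition `r_{A,B} = r_{A∪B, A∩B} + r_{A∖B, B∖A}` (tree:
`Pollard.rep_eq_rep_union_inter_add`) with the induction hypothesis for `(A ∪ B, A ∩ B)` if `t ≤ |A ∩ B|`, and for
`(A ∖ B, B ∖ A)` with `t′ = t − |A ∩ B|` otherwise).  Rendering: the defect enters as a hypothesis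
`∀ H : AddSubgroup G, H ≠ ⊤ → Nat.card H ≤ D` on a parameter `D` (so the theorem holds for every upper bound
`D` of the defect, in particular for the defect itself); `min(n, k + l − D − t)` with truncated subtraction in `ℕ`
(the printed bound is vacuous when `k + l − D − t < 0`).

## References
* B. Green, I. Z. Ruzsa, Israel J. Math. 147 (2005) 157–188, §6 Proposition 27 [cite: GreenRuzsa2005, Prop 27].
* J. M. Pollard, J. London Math. Soc. (2) 8 (1974) 460–462 [cite: Pollard1974, Thm 1].
-/

namespace Literature.Combinatorics.Additive

namespace GreenRuzsa

open Finset Pollard Grynkiewicz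
open scoped Pointwise

variable {G : Type*} [AddCommGroup G] [DecidableEq G] [Fintype G]

/-! ### Tools -/

/-- The popular-sum count `Σ_x min(t, r_{A,B}(x))` is symmetric in `A, B`. [cite: GreenRuzsa2005, Prop 27] -/
theorem sum_min_rep_comm (t : ℕ) (A B : Finset G) :
    ∑ x, min t (rep A B x) = ∑ x, min t (rep B A x) := by
  simp_rw [rep_comm A B]

/-- Translating `B` does not change `Σ_x min(t, r_{A,B}(x))`. [cite: GreenRuzsa2005, Prop 27] -/
theorem sum_min_rep_vadd_right (t : ℕ) (A B : Finset G) (g : G) :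
    ∑ x, min t (rep A (g +ᵥ B) x) = ∑ x, min t (rep A B x) := by
  simp_rw [rep_vadd_right]
  exact Fintype.sum_equiv (Equiv.subRight g) _ _ fun x => rfl

/-- Translating `A` does not change `Σ_x min(t, r_{A,B}(x))`. [cite: GreenRuzsa2005, Prop 27] -/
theorem sum_min_rep_vadd_left (t : ℕ) (A B : Finset G) (g : G) :
    ∑ x, min t (rep (g +ᵥ A) B x) = ∑ x, min t (rep A B x) := by
  rw [sum_min_rep_comm, sum_min_rep_vadd_right, sum_min_rep_comm]

/-- `Σ_x min(t, r_{A,B}(x)) ≤ t |G|`. [cite: GreenRuzsa2005, Prop 27] -/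
theorem sum_min_rep_le (t : ℕ) (A B : Finset G) : ∑ x, min t (rep A B x) ≤ t * Fintype.card G := by
  calc ∑ x, min t (rep A B x) ≤ ∑ _x : G, t := sum_le_sum fun x _ => min_le_left _ _
    _ = t * Fintype.card G := by rw [sum_const, smul_eq_mul, card_univ, mul_comm]

/-- If `r_{A,B}(x) ≤ t` everywhere then `Σ_x min(t, r_{A,B}(x)) = |A||B|`. [cite: GreenRuzsa2005, Prop 27] -/
theorem sum_min_rep_eq_card_mul_card {t : ℕ} {A B : Finset G} (h : ∀ x, rep A B x ≤ t) :
    ∑ x, min t (rep A B x) = A.card * B.card := by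
  rw [← sum_rep A B]
  exact sum_congr rfl fun x _ => min_eq_right (h x)

/-- The defect bounds the stabilizer of a nonempty finset which is not the whole group.
[cite: GreenRuzsa2005, Prop 27] -/
theorem card_addStab_le_defect {D : ℕ} (hD : ∀ H : AddSubgroup G, H ≠ ⊤ → Nat.card H ≤ D)
    {A : Finset G} (hA : A.Nonempty) (hAu : A ≠ univ) : A.addStab.card ≤ D := by
  set H : AddSubgroup G := AddAction.stabilizer G (A : Set G) with hH
  have hcoe : (A.addStab : Set G) = (H : Set G) := by
    rw [hH]
    have := coe_addStab hA
    simpa using this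
  have hHtop : H ≠ ⊤ := by
    intro htop
    apply hAu
    rcases id hA with ⟨a, ha⟩
    refine eq_univ_of_forall fun g => ?_
    have hg : g - a ∈ A.addStab := by
      rw [← mem_coe, hcoe, htop]; trivial
    rw [mem_addStab hA] at hg
    rw [← hg]
    exact mem_vadd_finset.2 ⟨a, ha, by simp⟩
  have hcard : Nat.card H = A.addStab.card := by
    have e : Nat.card H = Nat.card (A.addStab : Set G) := by rw [hcoe]; rfl
    rw [e, Nat.card_coe_set_eq, Set.ncard_coe_finset]
  exact hcard ▸ hD H hHtop

/-- The arithmetic of Case 2 of the printed proof: `|U||I| + t′(k′ + l′ − D − t′) ≥ t(k + l − D − t)` with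
`k = k′ + i`, `l = l′ + i`, `t = i + t′`, `|U| = k′ + l′ + i` (truncated subtractions included).
[cite: GreenRuzsa2005, Prop 27] -/
theorem key_arith (ka lb i t' D : ℕ) :
    (i + t') * (ka + i + (lb + i) - D - (i + t')) ≤ (ka + lb + i) * i + t' * (ka + lb - D - t') := by
  by_cases h1 : D + (i + t') ≤ ka + i + (lb + i)
  · obtain ⟨m, hm⟩ : ∃ m, ka + i + (lb + i) = D + (i + t') + m := ⟨ka + i + (lb + i) - (D + (i + t')), by omega⟩
    have e1 : ka + i + (lb + i) - D - (i + t') = m := by omega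
    rw [e1]
    by_cases h2 : D + t' ≤ ka + lb
    · obtain ⟨m', hm'⟩ : ∃ m', ka + lb = D + t' + m' := ⟨ka + lb - (D + t'), by omega⟩
      have e3 : ka + lb - D - t' = m' := by omega
      rw [e3]
      have hmm : m = m' + i := by omega
      subst hmm
      have hS : ka + lb + i = D + t' + m' + i := by omega
      rw [hS]
      nlinarith
    · have e3 : ka + lb - D - t' = 0 := by omega
      rw [e3, mul_zero, add_zero]
      have hmi : m < i := by omega
      have hS : ka + lb + i = D + t' + m := by omega
      rw [hS]
      nlinarith [hmi]
  · have e1 : ka + i + (lb + i) - D - (i + t') = 0 := by omega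
    rw [e1, mul_zero]; exact Nat.zero_le _

/-! ### Proposition 27 -/

/-- The inductive core of Proposition 27 (induction on `|B|`, with `|B| ≤ |A|`). [cite: GreenRuzsa2005, Prop 27] -/
theorem prop27_aux {D : ℕ} (hD : ∀ H : AddSubgroup G, H ≠ ⊤ → Nat.card H ≤ D) :
    ∀ (l : ℕ) (A B : Finset G), B.card = l → l ≤ A.card → ∀ t : ℕ, t ≤ l →
      t * min (Fintype.card G) (A.card + B.card - D - t) ≤ ∑ x, min t (rep A B x) := by
  intro l
  induction l using Nat.strong_induction_on with
  | _ l IH =>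
    intro A B hBl hlA t htl
    set n := Fintype.card G with hn
    -- the case `t = l`: every `r ≤ l = t`, the sum is `k l`
    by_cases htl' : t = l
    · subst htl'
      rw [sum_min_rep_eq_card_mul_card (fun x => hBl ▸ rep_le_card_right A B x), hBl]
      calc t * min n (A.card + t - D - t) ≤ t * A.card :=
            Nat.mul_le_mul_left _ ((min_le_right _ _).trans (by omega))
        _ = A.card * t := mul_comm _ _
    have htl2 : t < l := lt_of_le_of_ne htl htl'
    have hBne : B.Nonempty := card_pos.1 (by omega)
    have hAne : A.Nonempty := card_pos.1 (by omega)
    -- the pigeonhole case `k + l − D − t > n`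
    by_cases hpig : n < A.card + B.card - D - t
    · have hAB : A + B = univ := by
        refine eq_univ_of_forall fun g => ?_
        by_contra hg
        have hdisj : Disjoint (A.image (fun a => g - a)) B := by
          rw [disjoint_left]
          intro x hx hxB
          obtain ⟨a, ha, rfl⟩ := mem_image.1 hx
          exact hg (by rw [show g = a + (g - a) by abel]; exact add_mem_add ha hxB)
        have hinj : Set.InjOn (fun a => g - a) ↑A := fun a _ b _ (e : g - a = g - b) => by simpa using e
        have := card_le_univ (A.image (fun a => g - a) ∪ B)
        rw [card_union_of_disjoint hdisj, card_image_of_injOn hinj] at this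
        omega
      have hall : ∀ x, t ≤ rep A B x := by
        intro x
        have hx : x ∈ A + B := by rw [hAB]; exact mem_univ x
        have hc : (A + B).card + (A.card + B.card - n) ≤ A.card + B.card := by
          rw [hAB, card_univ]; omega
        exact le_trans (by omega) (le_rep_of_card_add_le hc hx)
      calc t * min n (A.card + B.card - D - t) ≤ t * n := Nat.mul_le_mul_left t (min_le_left _ _)
        _ = ∑ _x : G, t := by rw [sum_const, smul_eq_mul, card_univ, mul_comm]
        _ ≤ ∑ x, min t (rep A B x) := sum_le_sum fun x _ => le_min le_rfl (hall x)
    rw [not_lt] at hpig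
    rw [min_eq_right hpig]
    -- WLOG `0 ∈ B`
    obtain ⟨b₀, hb₀⟩ := hBne
    rw [← sum_min_rep_vadd_right t A B (-b₀)]
    have hB₁0 : (0 : G) ∈ (-b₀) +ᵥ B := mem_vadd_finset.2 ⟨b₀, hb₀, by simp⟩
    have hB₁c : ((-b₀) +ᵥ B).card = B.card := card_vadd_finset _ _
    rw [← hB₁c] at hBl hpig ⊢
    generalize (-b₀) +ᵥ B = B₁ at hB₁0 hBl hpig ⊢
    -- Case 1: `A + B₁ = A`, i.e. `B₁ ⊆ stab A`
    by_cases hcase : B₁ ⊆ A.addStab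
    · by_cases hAu : A = univ
      · -- `A = G`: every `x` has `r = l ≥ t`
        have hall : ∀ x, t ≤ rep A B₁ x := by
          intro x
          rw [rep_eq_card_filter_right]
          have : B₁.filter (fun b => x - b ∈ A) = B₁ := filter_true_of_mem fun b _ => by
            rw [hAu]; exact mem_univ _
          rw [this]; omega
        calc t * (A.card + B₁.card - D - t) ≤ t * n := Nat.mul_le_mul_left t hpig
          _ = ∑ _x : G, t := by rw [sum_const, smul_eq_mul, card_univ, mul_comm]
          _ ≤ ∑ x, min t (rep A B₁ x) := sum_le_sum fun x _ => le_min le_rfl (hall x)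
      · have hDl : B₁.card ≤ D := (card_le_card hcase).trans (card_addStab_le_defect hD hAne hAu)
        -- every `x ∈ A` has `r(x) = l ≥ t`
        have hA : ∀ x ∈ A, t ≤ rep A B₁ x := by
          intro x hx
          rw [rep_eq_card_filter_right]
          have : B₁.filter (fun b => x - b ∈ A) = B₁ := filter_true_of_mem fun b hb => by
            have hb' : -b ∈ A.addStab := neg_mem_addStab (hcase hb)
            rw [mem_addStab hAne] at hb'
            rw [← hb', sub_eq_add_neg, add_comm]
            exact mem_vadd_finset.2 ⟨x, hx, rfl⟩
          rw [this]; omega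
        calc t * (A.card + B₁.card - D - t) ≤ t * A.card := Nat.mul_le_mul_left t (by omega)
          _ = ∑ x ∈ A, t := by rw [sum_const, smul_eq_mul, mul_comm]
          _ ≤ ∑ x ∈ A, min t (rep A B₁ x) := sum_le_sum fun x hx => le_min le_rfl (hA x hx)
          _ ≤ ∑ x, min t (rep A B₁ x) := sum_le_sum_of_subset_of_nonneg (subset_univ A) fun _ _ _ => Nat.zero_le _
    · -- Case 2: some `a ∈ A`, `b ∈ B₁` with `a + b ∉ A`; translate `A` by `-a`
      rw [← add_subset_left_iff hAne] at hcase
      obtain ⟨w, hw, hwA⟩ := not_subset.1 hcase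
      obtain ⟨a, ha, b, hb, rfl⟩ := mem_add.1 hw
      rw [← sum_min_rep_vadd_left t A B₁ (-a)]
      have hA₁0 : (0 : G) ∈ (-a) +ᵥ A := mem_vadd_finset.2 ⟨a, ha, by simp⟩
      have hbA₁ : b ∉ (-a) +ᵥ A := by
        intro hb'
        obtain ⟨a', ha', e⟩ := mem_vadd_finset.1 hb'
        apply hwA
        have : a + b = a' := by rw [← e]; simp [vadd_eq_add]
        rw [this]; exact ha'
      have hA₁c : ((-a) +ᵥ A).card = A.card := card_vadd_finset _ _
      rw [← hA₁c] at hlA hpig ⊢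
      generalize (-a) +ᵥ A = A₁ at hA₁0 hbA₁ hlA hpig ⊢
      -- the Dyson pair
      set U := A₁ ∪ B₁ with hU
      set I := A₁ ∩ B₁ with hI
      have hI0 : (0 : G) ∈ I := mem_inter.2 ⟨hA₁0, hB₁0⟩
      have hIpos : 1 ≤ I.card := card_pos.2 ⟨0, hI0⟩
      have hIl : I.card < l := by
        rw [← hBl]
        exact card_lt_card ⟨inter_subset_right, fun h => hbA₁ (mem_inter.1 (h hb)).1⟩
      have hUI : U.card + I.card = A₁.card + B₁.card := card_union_add_card_inter _ _
      have hIU : I.card ≤ U.card := card_le_card (inter_subset_left.trans subset_union_left)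
      have hdec : ∀ x, rep A₁ B₁ x = rep U I x + rep (A₁ \ B₁) (B₁ \ A₁) x := rep_eq_rep_union_inter_add A₁ B₁
      by_cases htI : t ≤ I.card
      · -- induction for `(U, I)`
        have ih := IH I.card hIl U I rfl hIU t htI
        rw [hUI, min_eq_right hpig] at ih
        refine ih.trans (sum_le_sum fun x _ => ?_)
        rw [hdec x]
        exact min_le_min_left _ (Nat.le_add_right _ _)
      · -- `|I| < t < l`: induction for `(A₁ \\ B₁, B₁ \\ A₁)` with `t' = t − |I|`
        rw [not_le] at htI
        set A' := A₁ \ B₁ with hA'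
        set B' := B₁ \ A₁ with hB'
        have hA'c : A'.card + I.card = A₁.card := by
          rw [hA', hI]; exact card_sdiff_add_card_inter A₁ B₁
        have hB'c : B'.card + I.card = B₁.card := by
          rw [hB', hI, inter_comm]; exact card_sdiff_add_card_inter B₁ A₁
        have ih := IH B'.card (by omega) A' B' rfl (by omega) (t - I.card) (by omega)
        have hpig' : A'.card + B'.card - D - (t - I.card) ≤ n := by omega
        rw [min_eq_right hpig'] at ih
        -- `Σ min(|I|, r(U,I,x)) = |U||I|`
        have hUIsum : ∑ x, min I.card (rep U I x) = U.card * I.card :=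
          sum_min_rep_eq_card_mul_card fun x => rep_le_card_right U I x
        have hsplit : ∑ x, (min I.card (rep U I x) + min (t - I.card) (rep A' B' x)) ≤
            ∑ x, min t (rep A₁ B₁ x) := by
          refine sum_le_sum fun x _ => ?_
          rw [hdec x]
          have e : t = I.card + (t - I.card) := by omega
          conv_rhs => rw [e]
          exact min_add_min_le_min_add_add
        rw [sum_add_distrib, hUIsum] at hsplit
        -- arithmetic: `|U||I| + t'(k'+l'−D−t') ≥ t(k+l−D−t)`
        have key : t * (A₁.card + B₁.card - D - t) ≤
            U.card * I.card + (t - I.card) * (A'.card + B'.card - D - (t - I.card)) := by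
          obtain ⟨t', ht'⟩ : ∃ t', t = I.card + t' := ⟨t - I.card, by omega⟩
          have hU' : U.card = A'.card + B'.card + I.card := by omega
          have hA1 : A₁.card = A'.card + I.card := hA'c.symm
          have hB1 : B₁.card = B'.card + I.card := hB'c.symm
          rw [ht', Nat.add_sub_cancel_left, hU', hA1, hB1]
          exact key_arith A'.card B'.card I.card t' D
        exact key.trans ((Nat.add_le_add_left ih _).trans hsplit)

/-- **Green–Ruzsa 2005, Proposition 27** (the Pollard–Kneser bound with the defect).  Let `G` be a finite abelian
group all of whose proper subgroups have at most `D` elements (e.g. `D = D(G)`, the defect).  For `A, B ⊆ G`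
and `t ≤ min(|A|, |B|)`: `Σ_{x ∈ G} min(t, r_{A,B}(x)) ≥ t · min(|G|, |A| + |B| − D − t)`.
[cite: GreenRuzsa2005, Prop 27] -/
theorem greenRuzsa2005_prop27 {D : ℕ} (hD : ∀ H : AddSubgroup G, H ≠ ⊤ → Nat.card H ≤ D)
    (A B : Finset G) {t : ℕ} (htA : t ≤ A.card) (htB : t ≤ B.card) :
    t * min (Fintype.card G) (A.card + B.card - D - t) ≤ ∑ x, min t (rep A B x) := by
  rcases le_total B.card A.card with h | h
  · exact prop27_aux hD B.card A B rfl h t htB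
  · rw [sum_min_rep_comm, add_comm A.card]
    exact prop27_aux hD A.card B A rfl h t htA

/-- Proposition 27 over the sumset: `Σ_{x ∈ A+B} min(t, r_{A,B}(x)) = N_t(A,B) ≥ t · min(|G|, |A|+|B|−D−t)`
(representation counts vanish off `A + B`). [cite: GreenRuzsa2005, Prop 27] -/
theorem greenRuzsa2005_prop27_NS {D : ℕ} (hD : ∀ H : AddSubgroup G, H ≠ ⊤ → Nat.card H ≤ D)
    (A B : Finset G) {t : ℕ} (htA : t ≤ A.card) (htB : t ≤ B.card) :
    t * min (Fintype.card G) (A.card + B.card - D - t) ≤ NS t A B := by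
  have h := greenRuzsa2005_prop27 hD A B htA htB
  unfold NS
  rwa [← sum_subset (subset_univ (A + B)) (fun w _ hw => by simp [rep_eq_zero_of_not_mem hw])] at h

end GreenRuzsa

end Literature.Combinatorics.Additive
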